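import Summits.CriticalPhenomena.CardyFormulaZ2.Theses.CardyWhiteToColoured
import Literature.Probability.RandomPlanarGeometry.ConformalRectangleProofs
import Summits.CriticalPhenomena.CardyFormulaZ2.Theorems.CardyWhiteToColouredSimilarityUpgradeStubRectilinearSandwich
import Summits.CriticalPhenomena.CardyFormulaZ2.Theorems.CardyWhiteToColouredSimilarityUpgradeStubRectangleFamily
import Summits.CriticalPhenomena.CardyFormulaZ2.Theorems.CardyWhiteToColouredSimilarityUpgradeStubRectangleDuality

/-!
# `SimilarityUpgrade` reduced to its rectilinear heart (crux stmt-CriticalPhenomena-4597)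

Route `CardyWhiteToColoured`, sub-problem `CardyFormulaZ2`, line `registered` of crux
`Summit.CriticalPhenomena.CardyFormulaZ2.Theses.CardyWhiteToColoured.SimilarityUpgrade`.

This file is the sorry-free COMPOSITION of the line with its three landed stubs
(`Stubs.stub_rectilinearSandwich`, `Stubs.stub_rectangleFamily`, `Stubs.stub_rectangleDuality`),
leaving the heart as an explicit hypothesis: **if full, similarity-invariant bond-ℤ² crossing
limits factor through the conformal modulus on RECTILINEAR conformal rectangles via some `f`
continuous on `(0,1)` (the heart, registered stub `stub_rectilinearModulus`, open-problem class;
spelled out as the hypothesis `hH`), then `SimilarityUpgrade` holds**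
(`similarityUpgrade_of_rectilinearModulusUpgrade`).  In particular
the crux is now equivalent, modulo tree theorems, to "similarity ⇒ conformal" on rectilinear
polygons with a continuous modulus function.

Proof.  Given the crux hypothesis `⟨Φ, hlim, hsim⟩`, the heart gives `f`; the duality symmetry
`f η + f (1 - η) = 1` follows from the rectangle families (`stub_rectangleFamily`: corner-marked
boxes `(0,w) × (0,1)` crossed left–right / bottom–top, their moduli `η`, `1 - η`, all of `(0,1)`
realised, `η` continuous in `w`) and rectangle duality in the limit (`stub_rectangleDuality`:
`Φ (Q w) + Φ (Q' w) = 1`); the sandwich (`stub_rectilinearSandwich`) spreads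
`Φ = f ∘ modulus` from rectilinear to all conformal rectangles; and the full limit rewritten
through `Φ R = f (crossRatio x)` is `R.HasCrossingLimit (bondDomainCrossingProb R) f`.

References: B. Bollobás, O. Riordan, *Percolation* (2006), Ch. 7; S. Smirnov (2001).
-/

noncomputable section

namespace Summit.CriticalPhenomena.CardyFormulaZ2.Theorems.SimilarityUpgradeReduction

open Filter Topology Set
open Literature.Probability.RandomPlanarGeometry
open Literature.Probability.Percolation (bondDomainCrossingProb)
open Summit.CriticalPhenomena.CardyFormulaZ2.Cruxes.SimilarityUpgrade

/-- **Flip symmetry of the modulus function** from the two landed rectangle stubs: if `Φ` has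
full limits and `Φ R = f (crossRatio x)` on rectilinear rectangles with `f` continuous on
`(0,1)`, then `f η + f (1 - η) = 1` for `η ∈ (0,1)`. -/
theorem flipSymmetric_of_factors {Φ : ConformalRectangle → ℝ} {f : ℝ → ℝ}
    (hlim : ∀ R : ConformalRectangle, Tendsto (bondDomainCrossingProb R) (𝓝[>] (0 : ℝ)) (𝓝 (Φ R)))
    (hf : ContinuousOn f (Ioo 0 1))
    (hfact : ∀ R : ConformalRectangle,
      (∃ S : Finset (ℂ × ℂ), (∀ p ∈ S, p.1.re = p.2.re ∨ p.1.im = p.2.im) ∧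
        frontier R.carrier ⊆ ⋃ p ∈ S, segment ℝ p.1 p.2) →
      ∀ (φ : ConformalEquiv UpperHalfPlane.upperHalfPlaneSet R.carrier) (x : Fin 4 → ℝ),
        R.IsUniformizing φ x → Φ R = f (crossRatio x)) :
    ∀ η ∈ Ioo (0 : ℝ) 1, f η + f (1 - η) = 1 := by
  obtain ⟨Q, Q', hQ, hQ', hrect, hflip, hmod, hcontmod⟩ := Stubs.stub_rectangleFamily
  -- the value of `Φ` on the two families through `f`
  have hval : ∀ w : ℝ, 0 < w →
      ∀ (φ : ConformalEquiv UpperHalfPlane.upperHalfPlaneSet (Q w).carrier) (x : Fin 4 → ℝ),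
        (Q w).IsUniformizing φ x →
          Φ (Q w) = f (crossRatio x) ∧ Φ (Q' w) = f (1 - crossRatio x) := by
    intro w hw φ x hφ
    obtain ⟨φ', x', hφ'⟩ := MarkedDomain.exists_isUniformizing_holds (Q' w)
    refine ⟨hfact (Q w) (hrect w hw).1 φ x hφ, ?_⟩
    rw [hfact (Q' w) (hrect w hw).2 φ' x' hφ', hflip w hw φ x φ' x' hφ hφ']
  intro η hη
  obtain ⟨w, hw, hηw⟩ := hmod η hη
  obtain ⟨φ, x, hφ⟩ := MarkedDomain.exists_isUniformizing_holds (Q w)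
  obtain ⟨h1, h2⟩ := hval w hw φ x hφ
  have hηx : crossRatio x = η := hηw φ x hφ
  -- continuity of `v ↦ Φ (Q' v)` at `w`
  have hcont : ContinuousAt (fun v => Φ (Q' v)) w := by
    rw [Metric.continuousAt_iff]
    intro ε hε
    have hy₀ : 1 - crossRatio x ∈ Ioo (0 : ℝ) 1 := by
      have hm := ConformalRectangle.crossRatio_mem_Ioo_of_isUniformizing hφ
      exact ⟨by linarith [hm.2], by linarith [hm.1]⟩
    have hfc : ContinuousAt f (1 - crossRatio x) := hf.continuousAt (isOpen_Ioo.mem_nhds hy₀)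
    obtain ⟨ε', hε', hfε⟩ := Metric.continuousAt_iff.1 hfc ε hε
    obtain ⟨ρ, hρ, hρmod⟩ := hcontmod w hw ε' hε'
    refine ⟨min ρ w, lt_min hρ hw, fun v hv => ?_⟩
    have hvρ : |v - w| < ρ := lt_of_lt_of_le hv (min_le_left _ _)
    have hvw : |v - w| < w := lt_of_lt_of_le hv (min_le_right _ _)
    have hv0 : 0 < v := by
      have := (abs_lt.1 hvw).1
      linarith
    obtain ⟨ψ, y, hψ⟩ := MarkedDomain.exists_isUniformizing_holds (Q v)
    obtain ⟨-, h2v⟩ := hval v hv0 ψ y hψ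
    change dist (Φ (Q' v)) (Φ (Q' w)) < ε
    rw [h2v, h2]
    refine hfε ?_
    have hcr : |crossRatio y - crossRatio x| < ε' := hρmod v hv0 hvρ ψ y φ x hψ hφ
    rw [Real.dist_eq]
    calc |1 - crossRatio y - (1 - crossRatio x)| = |crossRatio y - crossRatio x| := by
          rw [← abs_neg]; congr 1; ring
      _ < ε' := hcr
  have hsum := Stubs.stub_rectangleDuality Φ hlim Q Q' hQ hQ' w hw hcont
  rw [h1, h2, hηx] at hsum
  exact hsum

/-- **`SimilarityUpgrade` from its rectilinear heart** (sorry-free composition of the line with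
the three landed stubs): if full, similarity-invariant bond-ℤ² crossing limits factor through the
modulus on rectilinear conformal rectangles via a continuous `f` (hypothesis `hH`, the registered
heart stub `stub_rectilinearModulus` of the line, open-problem class; implied by
`CardyBoundaryCoulombGas.RectilinearCardy` with `f = cardyFunction`), then they factor through the
modulus everywhere, i.e. the route decl `SimilarityUpgrade` holds. -/
theorem similarityUpgrade_of_rectilinearModulusUpgrade :
    (∀ Φ : ConformalRectangle → ℝ,
      (∀ R : ConformalRectangle, Tendsto (bondDomainCrossingProb R) (𝓝[>] (0 : ℝ)) (𝓝 (Φ R))) →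
      (∀ (R R' : ConformalRectangle) (a w : ℂ), a ≠ 0 →
        R'.carrier = (fun z : ℂ => a * z + w) '' R.carrier →
        R'.arc 0 = (fun z : ℂ => a * z + w) '' R.arc 0 →
        R'.arc 2 = (fun z : ℂ => a * z + w) '' R.arc 2 → Φ R' = Φ R) →
      ∃ f : ℝ → ℝ, ContinuousOn f (Ioo 0 1) ∧
        ∀ R : ConformalRectangle,
          (∃ S : Finset (ℂ × ℂ), (∀ p ∈ S, p.1.re = p.2.re ∨ p.1.im = p.2.im) ∧
            frontier R.carrier ⊆ ⋃ p ∈ S, segment ℝ p.1 p.2) →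
          ∀ (φ : ConformalEquiv UpperHalfPlane.upperHalfPlaneSet R.carrier) (x : Fin 4 → ℝ),
            R.IsUniformizing φ x → Φ R = f (crossRatio x)) →
    Summit.CriticalPhenomena.CardyFormulaZ2.Theses.CardyWhiteToColoured.SimilarityUpgrade := by
  intro hH
  rintro ⟨Φ, hlim, hsim⟩
  obtain ⟨f, hf, hfact⟩ := hH Φ hlim hsim
  have hflip : ∀ η ∈ Ioo (0 : ℝ) 1, f η + f (1 - η) = 1 := flipSymmetric_of_factors hlim hf hfact
  have hall := Stubs.stub_rectilinearSandwich Φ f hlim hf hflip hfact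
  refine ⟨f, fun R => ?_⟩
  intro φ x hux
  rw [← hall R φ x hux]
  exact hlim R

end Summit.CriticalPhenomena.CardyFormulaZ2.Theorems.SimilarityUpgradeReduction

end
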